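import Mathlib.CategoryTheory.Comma.Over.Basic
import Mathlib.CategoryTheory.IsConnected
import Mathlib.CategoryTheory.EpiMono
import Mathlib.CategoryTheory.Functor.FullyFaithful
import Mathlib.CategoryTheory.EssentialImage
import Mathlib.CategoryTheory.Whiskering
import Literature.AlgebraicGeometry.Frobenioids.Categories
import Literature.AlgebraicGeometry.Frobenioids.CategoriesFactorization
import Literature.AlgebraicGeometry.Frobenioids.Dissection
import HarnessLib

/-!
# Frobenioids II, Proposition 1.5: localizations of number fields (the categorical part)

Mochizuki, *The geometry of Frobenioids II: poly-Frobenioids*, Kyushu J. Math. **62** (2008)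
401–460, §1, Proposition 1.5 "Localizations of Number Fields" (i)–(ix), author's text pp. 13–15
[cite: MochizukiFrdII2008, Prop. 1.5 pp.13-15].

**Setting.** Proposition 1.5 takes the categories `P₀`, `E₀` and the functor `E₀ → P₀` of
Example 1.4 (the "localization" categories attached to a Galois extension `F̃/F` of a number field
and a valuation `v`; file `NumberFieldLocalizationCategories.lean`), an ARBITRARY category `P` with a
functor `P → P₀`, and forms the categorical fiber product `E := P ×_{P₀} E₀` ([FrdI] §0; `CFP` of
`CategoriesFactorization.lean`).  The printed proof uses `E₀ → P₀` only through the properties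
listed in Example 1.4 (ii): faithful, (arrow-wise) essentially surjective, the bijection
"`P₀` is reconstructed from `E₀` by inverting the `P₀`-isomorphisms" (the case `P = P₀` of (i), which
the proof calls "easily verified"), total epimorphicity, FSMFF-type.  Accordingly every item below
is stated for an abstract functor `π : E₀ ⥤ P₀` with exactly the hypotheses its proof consumes
(each a printed property of Example 1.4 (ii)); the printed Proposition is the special case
`π =` the projection `E₀ → P₀` of Example 1.4.  This is a generalisation of the hypotheses, not
of the conclusions; no conclusion is strengthened or weakened except where a docstring says so.

**Contents (one declaration per printed sub-item).**
* `IsProjIso` — "`P`-isomorphism": a morphism of `E` projecting to an isomorphism of `P` (p. 13);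
* `HomReconstruction π` — the printed bijection `lim_{E₃ → E₁} Hom_E(E₃, E₂) ⥲ Hom_P(P₁, P₂)`
  (inductive limit over `P`-isomorphisms `E₃ → E₁`) in elementary form: surjectivity, and
  injectivity in the strong form "two presentations of the same arrow have a common refinement by
  `P`-isomorphisms" (which implies injectivity of the colimit map);
* (i) `proj₁` faithful, arrow-wise essentially surjective, and `HomReconstruction` transfers from
  `π` to `E → P` — PROVED;
* (ii) `P` connected iff `E` connected — PROVED; (iii) `P` totally epimorphic iff `E` is — PROVED.
Items (iv)–(ix) are in the sequel file `NumberFieldLocalizationsAut.lean` (400-line limit).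

Nothing here is specific to number fields; nothing bears on [IUTchIII].
-/

namespace Literature.AlgebraicGeometry.Frobenioids

open CategoryTheory

universe v₀ v₁ v₂ u₀ u₁ u₂

namespace NFLoc

section General

variable {B : Type u₀} [Category.{v₀} B] {E : Type u₁} [Category.{v₁} E]

/-- A *`P`-isomorphism* for a functor `π : E → P`: a morphism of `E` that projects to an
isomorphism of `P` (FrdII Prop. 1.5, p. 13, there for `E = P ×_{P₀} E₀ → P`).
[cite: MochizukiFrdII2008, Prop. 1.5 p.13] -/
def IsProjIso (π : E ⥤ B) {X Y : E} (f : X ⟶ Y) : Prop := IsIso (π.map f)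

/-- Isomorphisms are `P`-isomorphisms. [cite: MochizukiFrdII2008, Prop. 1.5 p.13] -/
theorem isProjIso_of_isIso (π : E ⥤ B) {X Y : E} (f : X ⟶ Y) [IsIso f] : IsProjIso π f :=
  inferInstanceAs (IsIso (π.map f))

/-- "`P` may be reconstructed from `E` by inverting the `P`-isomorphisms" (FrdII Prop. 1.5 (i),
p. 13): the natural map `lim_{E₃ → E₁} Hom_E(E₃, E₂) → Hom_P(P₁, P₂)`, the inductive limit being
over `P`-isomorphisms `E₃ → E₁`, is bijective.  Elementary rendering: `surj` = every arrow
`π E₁ → π E₂` is presented by a `P`-isomorphism `s : E₃ → E₁` and an arrow `f : E₃ → E₂`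
(`π s ≫ g = π f`); `inj` = two presentations of the same arrow admit a common refinement by
`P`-isomorphisms (this implies that they are equal in the inductive limit).
[cite: MochizukiFrdII2008, Prop. 1.5 (i) p.13] -/
structure HomReconstruction (π : E ⥤ B) : Prop where
  /-- every arrow downstairs is `(π s)⁻¹ ≫ π f` for a `P`-isomorphism `s` -/
  surj : ∀ (X Y : E) (g : π.obj X ⟶ π.obj Y),
    ∃ (Z : E) (s : Z ⟶ X) (f : Z ⟶ Y), IsProjIso π s ∧ π.map s ≫ g = π.map f
  /-- two presentations of the same arrow have a common refinement -/
  inj : ∀ {X Y Z Z' : E} (s : Z ⟶ X) (f : Z ⟶ Y) (s' : Z' ⟶ X) (f' : Z' ⟶ Y)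
    (g : π.obj X ⟶ π.obj Y), IsProjIso π s → IsProjIso π s' →
    π.map s ≫ g = π.map f → π.map s' ≫ g = π.map f' →
    ∃ (W : E) (t : W ⟶ Z) (t' : W ⟶ Z'), IsProjIso π t ∧ IsProjIso π t' ∧
      t ≫ s = t' ≫ s' ∧ t ≫ f = t' ≫ f'

end General

section FiberProduct

variable {P₀ : Type u₀} [Category.{v₀} P₀] {E₀ : Type u₁} [Category.{v₁} E₀]
  {P : Type u₂} [Category.{v₂} P] (F : P ⥤ P₀) (π : E₀ ⥤ P₀)

/-! ### The fiber product `E = P ×_{P₀} E₀` and its projection to `P` -/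

/-- `E := P ×_{P₀} E₀`, the categorical fiber product of FrdII Prop. 1.5 (p. 13) — [FrdI] §0's CFP.
[cite: MochizukiFrdII2008, Prop. 1.5 p.13] -/
abbrev Loc : Type (max u₂ u₁ v₀) := CFP F π

/-- The natural projection `E → P` (FrdII Prop. 1.5, p. 13). [cite: MochizukiFrdII2008, Prop. 1.5 p.13] -/
abbrev toP : Loc F π ⥤ P := CFP.proj₁ F π

/-- The natural projection `E → E₀` (FrdII Prop. 1.5, p. 13). [cite: MochizukiFrdII2008, Prop. 1.5 p.13] -/
abbrev toE₀ : Loc F π ⥤ E₀ := CFP.proj₂ F π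

variable {F π}

/-- Components of the projection `E → P`. [cite: MochizukiFrdII2008, Prop. 1.5 p.13] -/
@[simp] theorem toP_obj (X : Loc F π) : (toP F π).obj X = X.fst := rfl

/-- Components of the projection `E → P`. [cite: MochizukiFrdII2008, Prop. 1.5 p.13] -/
@[simp] theorem toP_map {X Y : Loc F π} (f : X ⟶ Y) : (toP F π).map f = f.fst := rfl

/-- Components of the projection `E → E₀`. [cite: MochizukiFrdII2008, Prop. 1.5 p.13] -/
@[simp] theorem toE₀_obj (X : Loc F π) : (toE₀ F π).obj X = X.snd := rfl

/-- Components of the projection `E → E₀`. [cite: MochizukiFrdII2008, Prop. 1.5 p.13] -/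
@[simp] theorem toE₀_map {X Y : Loc F π} (f : X ⟶ Y) : (toE₀ F π).map f = f.snd := rfl

/-- A morphism of `E` is a `P`-isomorphism iff its `P`-component is an isomorphism.
[cite: MochizukiFrdII2008, Prop. 1.5 p.13] -/
theorem isProjIso_toP_iff {X Y : Loc F π} (f : X ⟶ Y) : IsProjIso (toP F π) f ↔ IsIso f.fst :=
  Iff.rfl

/-- In `E = P ×_{P₀} E₀` the `E₀`-component of a morphism is pinned down by its `P`-component:
`π(f₂) = α_X⁻¹ ≫ F(f₁) ≫ α_Y`. [cite: MochizukiFrdII2008, Prop. 1.5 (i) p.13] -/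
theorem map_snd_eq {X Y : Loc F π} (f : X ⟶ Y) :
    π.map f.snd = X.iso.inv ≫ F.map f.fst ≫ Y.iso.hom := by
  rw [Iso.eq_inv_comp]
  exact f.w.symm

/-- If `π` is faithful, a morphism of `E` is determined by its `P`-component.
[cite: MochizukiFrdII2008, Prop. 1.5 (i) p.13] -/
theorem hom_eq_of_fst_eq [π.Faithful] {X Y : Loc F π} {f g : X ⟶ Y} (h : f.fst = g.fst) : f = g := by
  apply CFP.hom_ext h
  apply π.map_injective
  rw [map_snd_eq, map_snd_eq, h]

/-! ### (i) `E → P` is faithful and arrow-wise essentially surjective; the `Hom`-bijection -/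

/-- FrdII Prop. 1.5 (i), first clause: `E → P` is faithful (given that `E₀ → P₀` is, Ex. 1.4 (ii)).
[cite: MochizukiFrdII2008, Prop. 1.5 (i) p.13] -/
theorem toP_faithful [π.Faithful] : (toP F π).Faithful :=
  ⟨fun h => hom_eq_of_fst_eq h⟩

/-- A lift of an arrow of `P` to an arrow of `E` with prescribed components: from isomorphisms
`F A ≅ π X₁`, `F A' ≅ π X₂` and `e : X₁ → X₂` over `F g`. [cite: MochizukiFrdII2008, Prop. 1.5 (i) p.13] -/
def liftHom {A A' : P} (g : A ⟶ A') {X₁ X₂ : E₀} (α : F.obj A ≅ π.obj X₁) (β : F.obj A' ≅ π.obj X₂)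
    (e : X₁ ⟶ X₂) (w : F.map g ≫ β.hom = α.hom ≫ π.map e) :
    (CFP.mk A X₁ α : Loc F π) ⟶ CFP.mk A' X₂ β :=
  ⟨g, e, w⟩

/-- FrdII Prop. 1.5 (i), second clause: `E → P` is arrow-wise essentially surjective (given that
`E₀ → P₀` is, Ex. 1.4 (ii)); in fact every arrow of `P` is literally the image of an arrow of `E`.
[cite: MochizukiFrdII2008, Prop. 1.5 (i) p.13] -/
theorem exists_hom_over (hπ : IsArrowwiseEssSurj π) {A A' : P} (g : A ⟶ A') :
    ∃ (X Y : Loc F π) (f : X ⟶ Y) (hX : X.fst = A) (hY : Y.fst = A'),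
      f.fst = eqToHom hX ≫ g ≫ eqToHom hY.symm := by
  obtain ⟨X₁, X₂, e, ⟨i⟩⟩ := hπ (F.map g)
  -- `i : Arrow.mk (π.map e) ≅ Arrow.mk (F.map g)`
  let α : F.obj A ≅ π.obj X₁ := (Arrow.leftFunc.mapIso i).symm
  let β : F.obj A' ≅ π.obj X₂ := (Arrow.rightFunc.mapIso i).symm
  have w : F.map g ≫ β.hom = α.hom ≫ π.map e := by
    have h1 := Arrow.w i.inv
    simp only [Arrow.mk_hom] at h1
    exact h1.symm
  exact ⟨CFP.mk A X₁ α, CFP.mk A' X₂ β, liftHom g α β e w, rfl, rfl, by simp [liftHom]⟩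

/-- FrdII Prop. 1.5 (i): `E → P` is arrow-wise essentially surjective.
[cite: MochizukiFrdII2008, Prop. 1.5 (i) p.13] -/
theorem isArrowwiseEssSurj_toP (hπ : IsArrowwiseEssSurj π) : IsArrowwiseEssSurj (toP F π) := by
  intro A A' g
  obtain ⟨X, Y, f, hX, hY, hf⟩ := exists_hom_over (F := F) hπ g
  subst hX hY
  refine ⟨X, Y, f, ?_⟩
  simp only [eqToHom_refl, Category.id_comp, Category.comp_id] at hf
  rw [show (toP F π).map f = g from hf]
  exact IsAbstractlyEquivalent.refl g

/-- `E → P` is essentially surjective as soon as `E₀ → P₀` is (used in (ii)).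
[cite: MochizukiFrdII2008, Prop. 1.5 (ii) p.13] -/
theorem toP_essSurj [π.EssSurj] : (toP F π).EssSurj :=
  ⟨fun A => ⟨CFP.mk A (π.objPreimage (F.obj A)) (π.objObjPreimageIso (F.obj A)).symm, ⟨Iso.refl A⟩⟩⟩

/-- An object of `E` over (an object equal to) a given object of `P`, when `E₀ → P₀` is essentially
surjective. [cite: MochizukiFrdII2008, Prop. 1.5 (ii) p.13] -/
theorem exists_obj_over [π.EssSurj] (A : P) : ∃ X : Loc F π, X.fst = A :=
  ⟨CFP.mk A (π.objPreimage (F.obj A)) (π.objObjPreimageIso (F.obj A)).symm, rfl⟩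

/-- FrdII Prop. 1.5 (i), the bijection: if `P₀` is reconstructed from `E₀` by inverting
`P₀`-isomorphisms ("the easily verified observation that such a bijection exists when `P → P₀` is
the identity functor", p. 14), then `P` is reconstructed from `E = P ×_{P₀} E₀` by inverting
`P`-isomorphisms. [cite: MochizukiFrdII2008, Prop. 1.5 (i) p.13] -/
theorem homReconstruction_toP (h : HomReconstruction π) : HomReconstruction (toP F π) := by
  constructor
  · intro X Y g
    change X.fst ⟶ Y.fst at g
    -- transport `F g` to `π X.snd → π Y.snd` and present it upstairs in `E₀`
    obtain ⟨Z₀, s₀, f₀, hs₀, hw⟩ :=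
      h.surj X.snd Y.snd (X.iso.inv ≫ F.map g ≫ Y.iso.hom)
    have hs₀' : IsIso (π.map s₀) := hs₀
    let γ : F.obj X.fst ≅ π.obj Z₀ := X.iso ≪≫ (asIso (π.map s₀)).symm
    refine ⟨CFP.mk X.fst Z₀ γ, ⟨𝟙 _, s₀, ?_⟩, ⟨g, f₀, ?_⟩, ?_, ?_⟩
    · simp [γ]
    · rw [← hw]
      simp [γ]
    · exact inferInstanceAs (IsIso (𝟙 X.fst))
    · simp
  · intro X Y Z Z' s f s' f' g hs hs' hsg hs'g
    change X.fst ⟶ Y.fst at g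
    have hs₁ : IsIso s.fst := hs
    have hs'₁ : IsIso s'.fst := hs'
    have hsg' : s.fst ≫ g = f.fst := hsg
    have hs'g' : s'.fst ≫ g = f'.fst := hs'g
    -- downstairs in `P₀` both pairs present the same arrow `X.iso⁻¹ ≫ F g ≫ Y.iso`
    have key : ∀ {W : Loc F π} (t : W ⟶ X) (k : W ⟶ Y), t.fst ≫ g = k.fst →
        π.map t.snd ≫ (X.iso.inv ≫ F.map g ≫ Y.iso.hom) = π.map k.snd := by
      intro W t k htk
      rw [map_snd_eq, map_snd_eq, ← htk, F.map_comp]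
      simp
    have hπs : IsProjIso π s.snd := by
      change IsIso (π.map s.snd); rw [map_snd_eq]; infer_instance
    have hπs' : IsProjIso π s'.snd := by
      change IsIso (π.map s'.snd); rw [map_snd_eq]; infer_instance
    obtain ⟨W₀, t₀, t₀', ht₀, ht₀', hts, htf⟩ :=
      h.inj s.snd f.snd s'.snd f'.snd _ hπs hπs' (key s f hsg') (key s' f' hs'g')
    have ht₀i : IsIso (π.map t₀) := ht₀
    have ht₀'i : IsIso (π.map t₀') := ht₀'
    let δ : F.obj Z.fst ≅ π.obj W₀ := Z.iso ≪≫ (asIso (π.map t₀)).symm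
    -- the refinement `W = (Z.fst, W₀, δ)` with `t = (𝟙, t₀)` and `t' = (s.fst ≫ inv s'.fst, t₀')`
    have e2 : π.map t₀' = π.map t₀ ≫ Z.iso.inv ≫ F.map s.fst ≫ inv (F.map s'.fst) ≫ Z'.iso.hom := by
      have e1 : π.map t₀ ≫ π.map s.snd = π.map t₀' ≫ π.map s'.snd := by
        rw [← π.map_comp, hts, π.map_comp]
      rw [map_snd_eq, map_snd_eq] at e1
      have e1' := e1 =≫ (X.iso.inv ≫ inv (F.map s'.fst) ≫ Z'.iso.hom)
      simp only [Category.assoc, Iso.hom_inv_id_assoc, IsIso.hom_inv_id_assoc, Iso.inv_hom_id,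
        Category.comp_id] at e1'
      exact e1'.symm
    have wt' : F.map (s.fst ≫ inv s'.fst) ≫ Z'.iso.hom = δ.hom ≫ π.map t₀' := by
      simp only [δ, Iso.trans_hom, Iso.symm_hom, asIso_inv, Category.assoc, e2,
        IsIso.inv_hom_id_assoc, Iso.hom_inv_id_assoc, F.map_comp, F.map_inv]
    refine ⟨CFP.mk Z.fst W₀ δ, ⟨𝟙 _, t₀, by simp [δ]⟩, ⟨s.fst ≫ inv s'.fst, t₀', wt'⟩,
      ?_, ?_, ?_, ?_⟩
    · exact inferInstanceAs (IsIso (𝟙 Z.fst))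
    · change IsIso (s.fst ≫ inv s'.fst); infer_instance
    · exact CFP.hom_ext (by simp) hts
    · refine CFP.hom_ext ?_ htf
      simp only [CFP.comp_fst, Category.id_comp, Category.assoc]
      rw [← hs'g', IsIso.inv_hom_id_assoc, hsg']


/-! ### Joint lifts (used for (iii), (v)) -/

/-- Joint lift of two arrows `b : A → Y₁`, `c : A → Y'₁` of `P` (targets = projections of objects of
`E`) to arrows of `E` out of a common object `W`, up to an isomorphism `W₁ ≅ A` — a formal
consequence of the reconstruction bijection of (i). [cite: MochizukiFrdII2008, Prop. 1.5 (i) p.13] -/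
theorem exists_lift₂ [π.EssSurj] (h : HomReconstruction π) (Y Y' : Loc F π) {A : P}
    (b : A ⟶ Y.fst) (c : A ⟶ Y'.fst) :
    ∃ (W : Loc F π) (w : W.fst ⟶ A) (u : W ⟶ Y) (u' : W ⟶ Y'),
      IsIso w ∧ u.fst = w ≫ b ∧ u'.fst = w ≫ c := by
  have hr := homReconstruction_toP (F := F) h
  obtain ⟨X, hX⟩ := exists_obj_over (F := F) (π := π) A
  subst hX
  obtain ⟨Z, s, f, hs, hsf⟩ := hr.surj X Y b
  obtain ⟨W, t, f', ht, htf⟩ := hr.surj Z Y' (s.fst ≫ c)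
  have hs' : IsIso s.fst := hs
  have ht' : IsIso t.fst := ht
  have hsf' : s.fst ≫ b = f.fst := hsf
  have htf' : t.fst ≫ s.fst ≫ c = f'.fst := htf
  refine ⟨W, t.fst ≫ s.fst, t ≫ f, f', inferInstance, ?_, ?_⟩
  · simp only [CFP.comp_fst, Category.assoc, hsf']
  · rw [Category.assoc, htf']

/-! ### (ii) connectedness -/

/-- Two objects of `E` whose projections are joined by an arrow of `P` are joined by a zigzag of
`E`. [cite: MochizukiFrdII2008, Prop. 1.5 (ii) p.13] -/
theorem zigzag_of_hom_fst (h : HomReconstruction π) (X Y : Loc F π) (g : X.fst ⟶ Y.fst) :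
    Zigzag X Y := by
  obtain ⟨Z, s, f, -, -⟩ := (homReconstruction_toP (F := F) h).surj X Y g
  exact (Zigzag.of_inv s).trans (Zigzag.of_hom f)

/-- Zigzags of `P` lift to zigzags of `E` ("by considering the fibers of the functor `E → P`",
p. 14). [cite: MochizukiFrdII2008, Prop. 1.5 (ii) p.14] -/
theorem zigzag_of_zigzag_fst [π.EssSurj] (h : HomReconstruction π) {A A' : P}
    (hz : Zigzag A A') :
    ∀ (X Y : Loc F π), (X.fst ≅ A) → (Y.fst ≅ A') → Zigzag X Y := by
  induction hz with
  | refl => intro X Y eX eY; exact zigzag_of_hom_fst h X Y (eX.hom ≫ eY.inv)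
  | @tail B C _ hBC ih =>
    intro X Y eX eY
    obtain ⟨Z, hZ⟩ := exists_obj_over (F := F) (π := π) B
    have h1 : Zigzag X Z := ih X Z eX (eqToIso hZ)
    rcases hBC with ⟨⟨g⟩⟩ | ⟨⟨g⟩⟩
    · exact h1.trans (zigzag_of_hom_fst h Z Y (eqToHom hZ ≫ g ≫ eY.inv))
    · exact h1.trans (zigzag_of_hom_fst h Y Z (eY.hom ≫ g ≫ eqToHom hZ.symm)).symm

/-- FrdII Prop. 1.5 (ii), "if": `P` connected ⇒ `E` connected.
[cite: MochizukiFrdII2008, Prop. 1.5 (ii) p.13] -/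
theorem isConnected_of_isConnected_fst [π.EssSurj] (h : HomReconstruction π) (hP : IsConnected P) :
    IsConnected (Loc F π) := by
  obtain ⟨X, -⟩ := exists_obj_over (F := F) (π := π) (Classical.arbitrary P)
  haveI : Nonempty (Loc F π) := ⟨X⟩
  exact zigzag_isConnected fun X Y =>
    zigzag_of_zigzag_fst h (isPreconnected_zigzag X.fst Y.fst) X Y (Iso.refl _) (Iso.refl _)

/-- FrdII Prop. 1.5 (ii), "only if": `E` connected ⇒ `P` connected ("since `E → P` is essentially
surjective"). [cite: MochizukiFrdII2008, Prop. 1.5 (ii) p.13] -/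
theorem isConnected_fst_of_isConnected [π.EssSurj] (hE : IsConnected (Loc F π)) :
    IsConnected P := by
  have X : Loc F π := Classical.arbitrary _
  haveI : Nonempty P := ⟨X.fst⟩
  refine zigzag_isConnected fun A A' => ?_
  obtain ⟨Y, hY⟩ := exists_obj_over (F := F) (π := π) A
  obtain ⟨Y', hY'⟩ := exists_obj_over (F := F) (π := π) A'
  subst hY hY'
  exact zigzag_obj_of_zigzag (toP F π) (isPreconnected_zigzag Y Y')

/-- FrdII Prop. 1.5 (ii): `P` is connected if and only if `E` is.
[cite: MochizukiFrdII2008, Prop. 1.5 (ii) p.13] -/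
theorem isConnected_iff [π.EssSurj] (h : HomReconstruction π) :
    IsConnected P ↔ IsConnected (Loc F π) :=
  ⟨fun hP => isConnected_of_isConnected_fst h hP, fun hE => isConnected_fst_of_isConnected hE⟩

/-! ### (iii) total epimorphicity -/

/-- FrdII Prop. 1.5 (iii), "if": `P` (and `E₀`, Ex. 1.4 (ii)) totally epimorphic ⇒ `E` totally
epimorphic. [cite: MochizukiFrdII2008, Prop. 1.5 (iii) p.14] -/
theorem isTotallyEpimorphic_of_fst (hP : IsTotallyEpimorphic P) (hE₀ : IsTotallyEpimorphic E₀) :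
    IsTotallyEpimorphic (Loc F π) := by
  refine ⟨fun f => ⟨fun g g' hgg' => ?_⟩⟩
  haveI := hP.epi f.fst
  haveI := hE₀.epi f.snd
  have h1 : f.fst ≫ g.fst = f.fst ≫ g'.fst := congrArg CFP.Hom.fst hgg'
  have h2 : f.snd ≫ g.snd = f.snd ≫ g'.snd := congrArg CFP.Hom.snd hgg'
  exact CFP.hom_ext ((cancel_epi f.fst).mp h1) ((cancel_epi f.snd).mp h2)

/-- FrdII Prop. 1.5 (iii), "only if": `E` totally epimorphic ⇒ `P` totally epimorphic (uses the
faithfulness of `E₀ → P₀` and the bijection of (i)). [cite: MochizukiFrdII2008, Prop. 1.5 (iii) p.14] -/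
theorem isTotallyEpimorphic_fst [π.Faithful] [π.EssSurj] (h : HomReconstruction π)
    (hE : IsTotallyEpimorphic (Loc F π)) : IsTotallyEpimorphic P := by
  refine ⟨fun {A₁ A₂} a => ⟨fun {A₃} b c hbc => ?_⟩⟩
  obtain ⟨Y, hY⟩ := exists_obj_over (F := F) (π := π) A₃
  subst hY
  obtain ⟨W, w, u, u', hw, hu, hu'⟩ := exists_lift₂ h Y Y b c
  haveI := hw
  obtain ⟨V, v, r, -, -, hr, -⟩ := exists_lift₂ h W W (a ≫ inv w) (a ≫ inv w)
  have key : r ≫ u = r ≫ u' := by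
    apply hom_eq_of_fst_eq
    simp only [CFP.comp_fst, hr, hu, hu', Category.assoc, IsIso.inv_hom_id_assoc, hbc]
  haveI := hE.epi r
  have h2 : u = u' := (cancel_epi r).mp key
  have h3 : w ≫ b = w ≫ c := by rw [← hu, ← hu', h2]
  exact (cancel_epi w).mp h3

/-- FrdII Prop. 1.5 (iii): `P` is totally epimorphic if and only if `E` is (given that `E₀` is and
`E₀ → P₀` is faithful with the reconstruction bijection, Ex. 1.4 (ii)).
[cite: MochizukiFrdII2008, Prop. 1.5 (iii) p.14] -/
theorem isTotallyEpimorphic_iff [π.Faithful] [π.EssSurj] (h : HomReconstruction π)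
    (hE₀ : IsTotallyEpimorphic E₀) : IsTotallyEpimorphic P ↔ IsTotallyEpimorphic (Loc F π) :=
  ⟨fun hP => isTotallyEpimorphic_of_fst hP hE₀, fun hE => isTotallyEpimorphic_fst h hE⟩

end FiberProduct

end NFLoc

end Literature.AlgebraicGeometry.Frobenioids
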